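import Literature.Probability.RandomPlanarGeometry.SLERestrictionHitPathAccess
import Literature.Probability.RandomPlanarGeometry.LoewnerSlidHullStar
import Literature.Probability.RandomPlanarGeometry.ArcStarHull
import Literature.Topology.PlaneTopology.ArcGluing
import HarnessLib

/-!
# The chain of arc hulls through a smooth hull hit by a Loewner hull

Set-up for the assembly of [LSW] Lemma 6.3 (`SLERestrictionHitAssembly`): inside a `*`-hull
`A` bounded by a Jordan arc, an **access arc** `Λ` (a simple arc from a real point `x_b` of `A`
into `int A`, `IsArcHull.exists_accessArc`) glued to a path `β : [x_*, 1] → int A ∪ ∂A`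
(injective, continuous, interior before time `1`) along which the hit point `β 1` is approached
gives the increasing family of simple arcs

  `Γ_x = Λ ∪ β[x_*, x]`,  `x_* < x < 1`,

hanging from `x_b`. We record: `Γ_x` is a simple arc from `x_b` (`isSimpleArc_chain`), a
`*`-hull (`isStarHull_chain`, via `isStarHull_of_arc`), its points other than `x_b` are
interior points of `A`, all its points are still flowing at the hitting time `T` of `A`
(`lt_swallowingTime_of_mem_chain`), and for `t < T` its slid image `g_t(Γ_x) - W_t` is a
`*`-hull contained in the slid hull of `A` (`isStarHull_slidHull_chain`).
-/

noncomputable section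

open Set Filter Metric Complex
open _root_.Topology
open UpperHalfPlane (upperHalfPlaneSet isOpen_upperHalfPlaneSet)
open Literature.Topology.PlaneTopology
open scoped NNReal unitInterval

namespace Literature.Probability.RandomPlanarGeometry

section Chain

variable {A Λ : Set ℂ} {β : ℝ → ℂ} {xb xs : ℝ}

/-- **Chain data**: an access arc `Λ` from the real point `x_b` to `β x_*`, meeting
`β[x_*, 1]` only at `β x_*`, all of whose other points are interior points of `A`; and the
path `β`, continuous and injective on `[0, 1]`, interior on `[0, 1)`. [folklore] -/
structure IsChainData (A Λ : Set ℂ) (β : ℝ → ℂ) (xb xs : ℝ) : Prop where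
  arc : IsSimpleArc Λ xb (β xs)
  base_mem : ((xb : ℝ) : ℂ) ∈ A
  arc_interior : ∀ z ∈ Λ, z ≠ xb → z ∈ interior A
  meet : Λ ∩ β '' Icc xs 1 ⊆ {β xs}
  xs_mem : xs ∈ Ico (0 : ℝ) 1
  cont : ContinuousOn β (Icc 0 1)
  inj : InjOn β (Icc 0 1)
  mem_int : ∀ x ∈ Ico (0 : ℝ) 1, β x ∈ interior A

variable (h : IsChainData A Λ β xb xs)
include h

/-- The chain set `Γ_x = Λ ∪ β[x_*, x]` is a simple arc from `x_b` to `β x`, for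
`x_* < x ≤ 1`. [folklore] -/
theorem IsChainData.isSimpleArc_chain {x : ℝ} (hx : xs < x) (hx1 : x ≤ 1) :
    IsSimpleArc (Λ ∪ β '' Icc xs x) xb (β x) := by
  refine h.arc.union (isSimpleArc_image_Icc h.cont h.inj h.xs_mem.1 hx hx1) fun z hz ↦ ?_
  exact h.meet ⟨hz.1, image_mono (Icc_subset_Icc_right hx1) hz.2⟩

/-- Points of the chain set other than the base point are interior points of `A` (for
`x < 1`). [folklore] -/
theorem IsChainData.mem_interior_of_mem_chain {x : ℝ} (hx1 : x < 1) {z : ℂ}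
    (hz : z ∈ Λ ∪ β '' Icc xs x) (hzb : z ≠ xb) : z ∈ interior A := by
  rcases hz with hz | ⟨y, hy, rfl⟩
  · exact h.arc_interior z hz hzb
  · exact h.mem_int y ⟨h.xs_mem.1.trans hy.1, lt_of_le_of_lt hy.2 hx1⟩

/-- The chain set lies in `A`. [folklore] -/
theorem IsChainData.chain_subset {x : ℝ} (hx1 : x < 1) : Λ ∪ β '' Icc xs x ⊆ A := fun z hz ↦ by
  by_cases hzb : z = xb
  · rw [hzb]; exact h.base_mem
  · exact interior_subset (h.mem_interior_of_mem_chain hx1 hz hzb)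

omit h in
/-- The chain sets increase with `x`. [folklore] -/
theorem IsChainData.chain_mono {x y : ℝ} (hxy : x ≤ y) : Λ ∪ β '' Icc xs x ⊆ Λ ∪ β '' Icc xs y :=
  union_subset_union_right _ (image_mono (Icc_subset_Icc_right hxy))

/-- The chain set is compact (for `x_* < x ≤ 1`). [folklore] -/
theorem IsChainData.isCompact_chain {x : ℝ} (hx : xs < x) (hx1 : x ≤ 1) : IsCompact (Λ ∪ β '' Icc xs x) :=
  (h.isSimpleArc_chain hx hx1).isCompact

/-- **The chain set is a `*`-hull** (a Jordan arc hanging from the real point `x_b` into `ℍ`,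
missing `0`). [folklore] -/
theorem IsChainData.isStarHull_chain (hA : IsStarHull A) {x : ℝ} (hx : xs < x) (hx1 : x < 1) :
    IsStarHull (Λ ∪ β '' Icc xs x) := by
  obtain ⟨e, he0, -⟩ := (h.isSimpleArc_chain hx hx1.le).exists_homeomorph
  refine isStarHull_of_arc e (by rw [he0, Complex.ofReal_im]) (fun s hs ↦ ?_) fun h0 ↦ hA.2 (h.chain_subset hx1 h0)
  have hne : ((e s : _) : ℂ) ≠ xb := fun heq ↦ hs (e.injective (Subtype.ext (by rw [heq, he0])))
  exact im_pos_of_mem_interior_hull hA.isBoundedHull (h.mem_interior_of_mem_chain hx1 (e s).2 hne)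

/-- **All points of the chain set are still flowing at the hitting time** of `A` (the base
point by hypothesis on real points, the others as interior points,
`IsHullHitTime.lt_swallowingTime_of_mem_interior`). [folklore] -/
theorem IsChainData.lt_swallowingTime_of_mem_chain {W : ℝ≥0 → ℝ} (hW : Continuous W) (hA : IsArcHull A)
    {τ : ℝ≥0} (hτ : Loewner.IsHullHitTime W A τ)
    (hreal : ∀ x : ℝ, (x : ℂ) ∈ A → ¬ Loewner.swallowingTime W x ≤ (τ : WithTop ℝ≥0))
    {x : ℝ} (hx1 : x < 1) {z : ℂ} (hz : z ∈ Λ ∪ β '' Icc xs x) :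
    (τ : WithTop ℝ≥0) < Loewner.swallowingTime W z := by
  by_cases hzb : z = xb
  · rw [hzb]; exact not_le.1 (hreal xb h.base_mem)
  · exact hτ.lt_swallowingTime_of_mem_interior hW hA hreal (h.mem_interior_of_mem_chain hx1 hz hzb)

/-- **The slid chain set is a `*`-hull contained in the slid hull of `A`**, for `t < T`.
[folklore] -/
theorem IsChainData.isStarHull_slidHull_chain {W : ℝ≥0 → ℝ} (hW : Continuous W) (hA : IsStarHull A)
    {τ : ℝ≥0} (hτ : Loewner.IsHullHitTime W A τ) {t : ℝ≥0} (ht : t < τ) {x : ℝ} (hx : xs < x) (hx1 : x < 1) :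
    IsStarHull (Loewner.slidHull W (Λ ∪ β '' Icc xs x) t) ∧
      Loewner.slidHull W (Λ ∪ β '' Icc xs x) t ⊆ Loewner.slidHull W A t :=
  ⟨Loewner.isStarHull_slidHull_of_disjoint hW (h.isStarHull_chain hA hx hx1)
    ((hτ.1 t ht).mono_right (h.chain_subset hx1)), image_mono (h.chain_subset hx1)⟩

end Chain

/-! ### Building chain data from an access arc and an injective hit path -/

/-- **Gluing an access arc to a hit path.** Let `β` be continuous and injective on `[0, 1]`
with `β[0, 1) ⊆ int A`, `β 1 ∉ int A`, `im β 1 > 0`, and let `η` be an access arc from the real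
point `x_b ∈ A` to `β 0` through `int A`. Cutting `η` at its first hit `η u₁ = β x_*` of
`β[0, 1]` yields chain data. [folklore] -/
theorem exists_isChainData {A : Set ℂ} (hA : IsBoundedHull A) {β η : ℝ → ℂ} {xb : ℝ}
    (hβc : ContinuousOn β (Icc 0 1)) (hβi : InjOn β (Icc 0 1)) (hβint : ∀ x ∈ Ico (0 : ℝ) 1, β x ∈ interior A)
    (hβ1 : β 1 ∉ interior A) (hβ1H : 0 < (β 1).im)
    (hηc : ContinuousOn η (Icc 0 1)) (hηi : InjOn η (Icc 0 1)) (hη0 : η 0 = xb) (hη1 : η 1 = β 0)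
    (hxb : ((xb : ℝ) : ℂ) ∈ A) (hηint : ∀ u ∈ Ioc (0 : ℝ) 1, η u ∈ interior A) :
    ∃ (Λ : Set ℂ) (xs : ℝ), IsChainData A Λ β xb xs := by
  -- the first hit of `C = β[0,1]` along `η`
  set C : Set ℂ := β '' Icc 0 1 with hC
  have hCc : IsCompact C := isCompact_Icc.image_of_continuousOn hβc
  have hreal_notMem : ((xb : ℝ) : ℂ) ∉ C := by
    rintro ⟨x, hx, hxe⟩
    have hxim : (β x).im = 0 := by rw [hxe, Complex.ofReal_im]
    rcases hx.2.eq_or_lt with h1 | h1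
    · rw [h1] at hxim; rw [hxim] at hβ1H; exact lt_irrefl _ hβ1H
    · have := im_pos_of_mem_interior_hull hA (hβint x ⟨hx.1, h1⟩)
      rw [hxim] at this
      exact lt_irrefl _ this
  have h0C : η 0 ∉ C := by rw [hη0]; exact hreal_notMem
  have h1C : η 1 ∈ C := by rw [hη1]; exact ⟨0, ⟨le_rfl, zero_le_one⟩, rfl⟩
  obtain ⟨u₁, hu₁, hu₁C, hbefore⟩ := exists_first_hit hηc hCc.isClosed h0C h1C
  obtain ⟨xs, hxs, hxse⟩ := hu₁C
  -- `x_* < 1`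
  have hqint : η u₁ ∈ interior A := hηint u₁ hu₁
  have hxs1 : xs < 1 := by
    rcases hxs.2.eq_or_lt with h1 | h1
    · exfalso; rw [h1] at hxse; rw [← hxse] at hqint; exact hβ1 hqint
    · exact h1
  refine ⟨η '' Icc 0 u₁, xs, ⟨?_, hxb, ?_, ?_, ⟨hxs.1, hxs1⟩, hβc, hβi, hβint⟩⟩
  · have h1 := isSimpleArc_image_Icc hηc hηi le_rfl hu₁.1 hu₁.2
    rwa [hη0, ← hxse] at h1
  · rintro _ ⟨u, hu, rfl⟩ hne
    have hu0 : u ≠ 0 := fun h0 ↦ hne (by rw [h0, hη0])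
    exact hηint u ⟨lt_of_le_of_ne hu.1 (Ne.symm hu0), hu.2.trans hu₁.2⟩
  · rintro _ ⟨⟨u, hu, rfl⟩, hzC⟩
    have hzC' : η u ∈ C := image_mono (Icc_subset_Icc_left hxs.1) hzC
    rcases hu.2.eq_or_lt with h1 | h1
    · rw [mem_singleton_iff, h1, hxse]
    · exact absurd hzC' (hbefore u ⟨hu.1, h1⟩)

end Literature.Probability.RandomPlanarGeometry
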